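import Literature.MathematicalPhysics.QuantumLattice.HubbardWave0RayleighProofs
import Literature.MathematicalPhysics.QuantumLattice.PairCorrelationsProofs
import Literature.MathematicalPhysics.QuantumLattice.PairFieldYangCeiling

/-!
# The block pair operator `B_a = Σ_{u ∈ [0,R)²} P_{a+u}`: inner kernel part plus boundary part

Support for the cruxes `NoInfraredPileUp` (stmt-HubbardSuperconductivity-18534) and
`NoNormalLimitState` (stmt-HubbardSuperconductivity-18533) of route `InfiniteVolumeFirst`: steps
S3+S4 of the coarse-tightness / atom-ceiling programme (`PLAN-coarse-tightness.md` attached to the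
item) — the LOCAL (block) version of the pair Gram bounds of
`Literature/MathematicalPhysics/QuantumLattice/FreeFermiGasPairGramBounds.lean`, feeding the
mesoscopic pair-order ceiling `(L²R⁴)⁻¹ Σ_a ‖B_a ψ‖²` of weak-coupling Hubbard ground states.

This file (3/4): the split of the block pair operator `B_a = Σ_{u ∈ [0,R)²} P_{a+u}`
(`P_x = localPair d L x`; the format of `tightnessExchange_boxSum_eq`) into the inner `d`-wave kernel
part `Σ_{u,v} K_d(u,v) (c_{a+u,↑}c_{a+v,↓} - c_{a+u,↓}c_{a+v,↑})`,
`K_d(u,v) = Σ_e [v = u + e] g_d(e)/√2` (`blockPairOperator_split_raw`), its symmetrisation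
(`sum_sum_smul_pair_sub_eq`), and the boundary part carried by the at most `4R` pairs `(u, e)`
whose translate leaves the block (`card_filter_not_exists_translate_le`), each a contraction times
`√2`: `‖∂_a ψ‖ ≤ 4√2 R ‖ψ‖` (`norm_toLp_blockBoundary_mulVec_le`). Registered stub:
`stub_coarseBlockPairOperatorSplit`.

Sources: J. Bardeen, L. N. Cooper, J. R. Schrieffer, Phys. Rev. 108 (1957) 1175, §II;
C. N. Yang, Rev. Mod. Phys. 34 (1962) 694, §3; O. Bratteli, D. W. Robinson, *Operator Algebras and
Quantum Statistical Mechanics II* §5.2.2 (`a(f)`); D. J. Scalapino, Phys. Rep. 250 (1995) 329, §2.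
Folklore finite-dimensional statements; no definition and no named fact is introduced.
-/


noncomputable section

-- the mandated namespace `Summit.<Summit>.<Problem>.Theorems` repeats `HubbardSuperconductivity`
-- (single-problem summit, D-0017), which the `dupNamespace` linter flags on every declaration
set_option linter.dupNamespace false

namespace Summit.HubbardSuperconductivity.HubbardSuperconductivity.Theorems.CoarseTightness

open Literature.MathematicalPhysics.QuantumLattice Literature.Probability.LatticeModels Matrix Finset
open Literature.MathematicalPhysics.QuantumLattice.RayleighBound
open scoped ComplexConjugate ComplexOrder

/-! ### Blocks of the fermionic torus: sites, orbitals, and the split of the block pair operator -/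

section Torus

open Classical

variable {L : ℕ} [NeZero L]

omit [NeZero L] in
/-- Block site arithmetic: if `v = u + e` coordinatewise in `ℤ` then `(a + u) + e = a + v` on the
torus. [folklore] -/
theorem blockSite_add_proj (a : TorusSite 2 L) {R : ℕ} {u v : Fin 2 → Fin R} {e : Site 2}
    (h : ∀ i, ((v i : ℕ) : ℤ) = ((u i : ℕ) : ℤ) + e i) :
    (a + fun i => ((u i : ℕ) : ZMod L)) + Torus.proj L e = a + fun i => ((v i : ℕ) : ZMod L) := by
  funext i
  simp only [Pi.add_apply, Torus.proj_apply]
  have hi := congrArg (Int.cast : ℤ → ZMod L) (h i)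
  push_cast at hi
  rw [hi, add_assoc]

omit [NeZero L] in
/-- The integer translate `u + e` of a block label determines the label. [folklore] -/
theorem blockLabel_unique {R : ℕ} {u v w : Fin 2 → Fin R} {e : Site 2}
    (hv : ∀ i, ((v i : ℕ) : ℤ) = ((u i : ℕ) : ℤ) + e i)
    (hw : ∀ i, ((w i : ℕ) : ℤ) = ((u i : ℕ) : ℤ) + e i) : v = w := by
  funext i
  exact Fin.ext (by exact_mod_cast (hv i).trans (hw i).symm)

/-- **Abstract split of a double sum of translated terms.** If every `(u, e)` term whose
translate exists (`P u e v` for some, necessarily unique, `v`) can be rewritten through `v`, then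
`Σ_u Σ_{e ∈ S} c_e • Op(u,e)` is the `v`-indexed inner part with kernel `Σ_{e} [P u e v] c_e` plus
the sum of the terms with no translate. [folklore] -/
theorem sum_sum_smul_split {U E M : Type*} [Fintype U] [AddCommGroup M] [Module ℂ M]
    (S : Finset E) (c : E → ℂ) (Op : U → E → M) (Op' : U → U → M) (P : U → E → U → Prop)
    [∀ u e v, Decidable (P u e v)] [DecidablePred fun p : U × E => ¬ ∃ v, P p.1 p.2 v]
    (h1 : ∀ u e v, P u e v → Op u e = Op' u v) (h2 : ∀ u e v w, P u e v → P u e w → v = w) :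
    ∑ u, ∑ e ∈ S, c e • Op u e =
      (∑ u, ∑ v, (∑ e ∈ S, if P u e v then c e else 0) • Op' u v) +
        ∑ p ∈ (Finset.univ ×ˢ S).filter (fun p => ¬ ∃ v, P p.1 p.2 v), c p.2 • Op p.1 p.2 := by
  -- pointwise split
  have hpt : ∀ u e, c e • Op u e =
      (∑ v, if P u e v then c e • Op' u v else 0) + (if ¬ ∃ v, P u e v then c e • Op u e else 0) := by
    intro u e
    by_cases hex : ∃ v, P u e v
    · obtain ⟨v₀, hv₀⟩ := hex
      rw [if_neg (not_not.mpr ⟨v₀, hv₀⟩), add_zero, Finset.sum_eq_single v₀, if_pos hv₀,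
        h1 u e v₀ hv₀]
      · intro v _ hv
        rw [if_neg fun h => hv (h2 u e v v₀ h hv₀)]
      · exact fun h => absurd (Finset.mem_univ _) h
    · rw [if_pos hex, Finset.sum_eq_zero fun v _ => if_neg fun h => hex ⟨v, h⟩, zero_add]
  rw [Finset.sum_congr rfl fun u _ => Finset.sum_congr rfl fun e (_ : e ∈ S) => hpt u e]
  simp only [Finset.sum_add_distrib]
  congr 1
  · refine Finset.sum_congr rfl fun u _ => ?_
    rw [Finset.sum_comm]
    refine Finset.sum_congr rfl fun v _ => ?_
    rw [Finset.sum_smul]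
    refine Finset.sum_congr rfl fun e _ => ?_
    split_ifs <;> simp
  · rw [Finset.sum_filter, Finset.sum_product]
    refine Finset.sum_congr rfl fun u _ => Finset.sum_congr rfl fun e _ => ?_
    exact if_congr Iff.rfl rfl rfl

/-- **Split of the block pair operator, raw form.** `B_a = Σ_{u ∈ [0,R)²} P_{a+u}` equals the
inner part `Σ_{u,v} K_d(u,v) (c_{a+u,↑} c_{a+v,↓} - c_{a+u,↓} c_{a+v,↑})` with the inner `d`-wave
kernel `K_d(u,v) = Σ_{e} [v = u + e] g_d(e)/√2`, plus the boundary part carried by the pairs `(u, e)`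
whose translate `u + e` leaves the block. Scalapino, Phys. Rep. 250 (1995) 329, §2 (the `d`-wave
pair field); elementary bookkeeping. [folklore] -/
theorem blockPairOperator_split_raw (a : TorusSite 2 L) (R : ℕ) :
    (∑ u : Fin 2 → Fin R, localPair dWaveFormFactor L (a + fun i => ((u i : ℕ) : ZMod L))) =
      (∑ u : Fin 2 → Fin R, ∑ v : Fin 2 → Fin R,
        (((∑ e ∈ insert (0 : Site 2) unitSteps,
            if (∀ i, ((v i : ℕ) : ℤ) = ((u i : ℕ) : ℤ) + e i) then dWaveFormFactor e / Real.sqrt 2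
            else 0 : ℝ) : ℂ)) •
          (annihilation (orb (FermionTorus.ofTorusSite (a + fun i => ((u i : ℕ) : ZMod L))) 0) *
              annihilation (orb (FermionTorus.ofTorusSite (a + fun i => ((v i : ℕ) : ZMod L))) 1) -
            annihilation (orb (FermionTorus.ofTorusSite (a + fun i => ((u i : ℕ) : ZMod L))) 1) *
              annihilation (orb (FermionTorus.ofTorusSite (a + fun i => ((v i : ℕ) : ZMod L))) 0))) +
      ∑ p ∈ ((Finset.univ : Finset (Fin 2 → Fin R)) ×ˢ insert (0 : Site 2) unitSteps).filter
          (fun p => ¬ ∃ v : Fin 2 → Fin R, ∀ i, ((v i : ℕ) : ℤ) = ((p.1 i : ℕ) : ℤ) + p.2 i),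
        ((dWaveFormFactor p.2 / Real.sqrt 2 : ℝ) : ℂ) •
          (annihilation (orb (FermionTorus.ofTorusSite (a + fun i => ((p.1 i : ℕ) : ZMod L))) 0) *
              annihilation (orb (FermionTorus.ofTorusSite
                ((a + fun i => ((p.1 i : ℕ) : ZMod L)) + Torus.proj L p.2)) 1) -
            annihilation (orb (FermionTorus.ofTorusSite (a + fun i => ((p.1 i : ℕ) : ZMod L))) 1) *
              annihilation (orb (FermionTorus.ofTorusSite
                ((a + fun i => ((p.1 i : ℕ) : ZMod L)) + Torus.proj L p.2)) 0)) := by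
  have h := sum_sum_smul_split (M := Matrix (Finset (Orb (FermionTorus 2 L)))
      (Finset (Orb (FermionTorus 2 L))) ℂ) (insert (0 : Site 2) unitSteps)
    (fun e => ((dWaveFormFactor e / Real.sqrt 2 : ℝ) : ℂ))
    (fun (u : Fin 2 → Fin R) (e : Site 2) =>
      annihilation (orb (FermionTorus.ofTorusSite (a + fun i => ((u i : ℕ) : ZMod L))) 0) *
          annihilation (orb (FermionTorus.ofTorusSite
            ((a + fun i => ((u i : ℕ) : ZMod L)) + Torus.proj L e)) 1) -
        annihilation (orb (FermionTorus.ofTorusSite (a + fun i => ((u i : ℕ) : ZMod L))) 1) *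
          annihilation (orb (FermionTorus.ofTorusSite
            ((a + fun i => ((u i : ℕ) : ZMod L)) + Torus.proj L e)) 0))
    (fun (u v : Fin 2 → Fin R) =>
      annihilation (orb (FermionTorus.ofTorusSite (a + fun i => ((u i : ℕ) : ZMod L))) 0) *
          annihilation (orb (FermionTorus.ofTorusSite (a + fun i => ((v i : ℕ) : ZMod L))) 1) -
        annihilation (orb (FermionTorus.ofTorusSite (a + fun i => ((u i : ℕ) : ZMod L))) 1) *
          annihilation (orb (FermionTorus.ofTorusSite (a + fun i => ((v i : ℕ) : ZMod L))) 0))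
    (fun u e v => ∀ i, ((v i : ℕ) : ℤ) = ((u i : ℕ) : ℤ) + e i)
    (fun u e v huv => by simp only [blockSite_add_proj a huv])
    (fun u e v w hv hw => blockLabel_unique hv hw)
  simp only [localPair]
  rw [h]
  congr 1
  refine Finset.sum_congr rfl fun u _ => Finset.sum_congr rfl fun v _ => ?_
  congr 1
  rw [Complex.ofReal_sum]
  refine Finset.sum_congr rfl fun e _ => ?_
  split_ifs <;> simp

/-- **Symmetrisation of the inner part.** `Σ_{u,v} K(u,v) (c_{u↑} c_{v↓} - c_{u↓} c_{v↑})
= Σ_{u,v} K(u,v) c_{u↑} c_{v↓} + Σ_{u,v} K(v,u) c_{u↑} c_{v↓}` (`-c_{u↓} c_{v↑} = c_{v↑} c_{u↓}` by the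
CAR, then rename). [folklore] -/
theorem sum_sum_smul_pair_sub_eq (a : TorusSite 2 L) (R : ℕ) (K : (Fin 2 → Fin R) → (Fin 2 → Fin R) → ℝ) :
    (∑ u : Fin 2 → Fin R, ∑ v : Fin 2 → Fin R, ((K u v : ℝ) : ℂ) •
        (annihilation (orb (FermionTorus.ofTorusSite (a + fun i => ((u i : ℕ) : ZMod L))) 0) *
            annihilation (orb (FermionTorus.ofTorusSite (a + fun i => ((v i : ℕ) : ZMod L))) 1) -
          annihilation (orb (FermionTorus.ofTorusSite (a + fun i => ((u i : ℕ) : ZMod L))) 1) *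
            annihilation (orb (FermionTorus.ofTorusSite (a + fun i => ((v i : ℕ) : ZMod L))) 0))) =
      (∑ u : Fin 2 → Fin R, ∑ v : Fin 2 → Fin R, ((K u v : ℝ) : ℂ) •
        (annihilation (orb (FermionTorus.ofTorusSite (a + fun i => ((u i : ℕ) : ZMod L))) 0) *
          annihilation (orb (FermionTorus.ofTorusSite (a + fun i => ((v i : ℕ) : ZMod L))) 1))) +
      ∑ u : Fin 2 → Fin R, ∑ v : Fin 2 → Fin R, ((K v u : ℝ) : ℂ) •
        (annihilation (orb (FermionTorus.ofTorusSite (a + fun i => ((u i : ℕ) : ZMod L))) 0) *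
          annihilation (orb (FermionTorus.ofTorusSite (a + fun i => ((v i : ℕ) : ZMod L))) 1)) := by
  have hanti : ∀ u v : Fin 2 → Fin R,
      annihilation (orb (FermionTorus.ofTorusSite (a + fun i => ((u i : ℕ) : ZMod L))) 0) *
            annihilation (orb (FermionTorus.ofTorusSite (a + fun i => ((v i : ℕ) : ZMod L))) 1) -
          annihilation (orb (FermionTorus.ofTorusSite (a + fun i => ((u i : ℕ) : ZMod L))) 1) *
            annihilation (orb (FermionTorus.ofTorusSite (a + fun i => ((v i : ℕ) : ZMod L))) 0) =
        annihilation (orb (FermionTorus.ofTorusSite (a + fun i => ((u i : ℕ) : ZMod L))) 0) *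
            annihilation (orb (FermionTorus.ofTorusSite (a + fun i => ((v i : ℕ) : ZMod L))) 1) +
          annihilation (orb (FermionTorus.ofTorusSite (a + fun i => ((v i : ℕ) : ZMod L))) 0) *
            annihilation (orb (FermionTorus.ofTorusSite (a + fun i => ((u i : ℕ) : ZMod L))) 1) := by
    intro u v
    have h := annihilation_anticommute_holds (ι := Orb (FermionTorus 2 L))
      (orb (FermionTorus.ofTorusSite (a + fun i => ((u i : ℕ) : ZMod L))) 1)
      (orb (FermionTorus.ofTorusSite (a + fun i => ((v i : ℕ) : ZMod L))) 0)
    rw [eq_neg_of_add_eq_zero_left h, sub_neg_eq_add]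
  simp_rw [hanti, smul_add, Finset.sum_add_distrib]
  congr 1
  rw [Finset.sum_comm]

/-! ### The boundary part: at most `4R` protruding pairs, each a contraction times `√2` -/

omit [NeZero L] in
/-- A label `u ∈ [0,R)²` whose translate by `+e_i` leaves the block has `u_i = R - 1`. [folklore] -/
theorem apply_eq_of_not_exists_translate_single {R : ℕ} {u : Fin 2 → Fin R} {i : Fin 2}
    (h : ¬ ∃ v : Fin 2 → Fin R, ∀ k, ((v k : ℕ) : ℤ) = ((u k : ℕ) : ℤ) + (Pi.single i 1 : Site 2) k) :
    (u i : ℕ) + 1 = R := by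
  by_contra hne
  have hlt : (u i : ℕ) + 1 < R := lt_of_le_of_ne (u i).isLt hne
  refine h ⟨Function.update u i ⟨(u i : ℕ) + 1, hlt⟩, fun k => ?_⟩
  by_cases hk : k = i
  · subst hk
    simp
  · rw [Function.update_of_ne hk, Pi.single_eq_of_ne hk, add_zero]

omit [NeZero L] in
/-- A label `u ∈ [0,R)²` whose translate by `-e_i` leaves the block has `u_i = 0`. [folklore] -/
theorem apply_eq_zero_of_not_exists_translate_neg_single {R : ℕ} {u : Fin 2 → Fin R} {i : Fin 2}
    (h : ¬ ∃ v : Fin 2 → Fin R, ∀ k, ((v k : ℕ) : ℤ) = ((u k : ℕ) : ℤ) + (-Pi.single i 1 : Site 2) k) :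
    (u i : ℕ) = 0 := by
  by_contra hne
  have hpos : 0 < (u i : ℕ) := Nat.pos_of_ne_zero hne
  have hlt : (u i : ℕ) - 1 < R := lt_of_le_of_lt (Nat.sub_le _ _) (u i).isLt
  refine h ⟨Function.update u i ⟨(u i : ℕ) - 1, hlt⟩, fun k => ?_⟩
  by_cases hk : k = i
  · subst hk
    simp only [Function.update_self, Fin.val_mk, Pi.neg_apply, Pi.single_eq_same]
    omega
  · rw [Function.update_of_ne hk, Pi.neg_apply, Pi.single_eq_of_ne hk, neg_zero, add_zero]

omit [NeZero L] in
/-- A face of the block `[0,R)²` (labels with a prescribed value of one coordinate) has at most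
`R` elements. [folklore] -/
theorem card_filter_apply_eq_le {R : ℕ} (i : Fin 2) (c : ℕ) :
    ((Finset.univ : Finset (Fin 2 → Fin R)).filter fun u => (u i : ℕ) = c).card ≤ R := by
  have h := Finset.card_le_card_of_injOn (s := (Finset.univ : Finset (Fin 2 → Fin R)).filter
      fun u => (u i : ℕ) = c) (t := (Finset.univ : Finset (Fin R))) (fun u => u i.rev)
    (fun _ _ => Finset.mem_coe.2 (Finset.mem_univ _)) ?_
  · simpa using h
  · intro u hu w hw huw
    simp only [Finset.coe_filter, Finset.mem_univ, true_and, Set.mem_setOf_eq] at hu hw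
    funext k
    have hi : u i = w i := Fin.ext (hu.trans hw.symm)
    have hrev : u i.rev = w i.rev := huw
    fin_cases i <;> fin_cases k
    · exact hi
    · exact hrev
    · exact hrev
    · exact hi

omit [NeZero L] in
/-- **At most `4R` pairs `(u, e)` protrude from the block**: for `e = 0` every translate stays, for
`e = ±e_i` the protruding labels lie on one face. [folklore] -/
theorem card_filter_not_exists_translate_le (R : ℕ) :
    (((Finset.univ : Finset (Fin 2 → Fin R)) ×ˢ insert (0 : Site 2) unitSteps).filter
        (fun p => ¬ ∃ v : Fin 2 → Fin R, ∀ i, ((v i : ℕ) : ℤ) = ((p.1 i : ℕ) : ℤ) + p.2 i)).card ≤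
      4 * R := by
  -- count fibrewise over the step `e`
  have hN : ∀ e ∈ insert (0 : Site 2) unitSteps,
      ((Finset.univ : Finset (Fin 2 → Fin R)).filter fun u =>
        ¬ ∃ v : Fin 2 → Fin R, ∀ i, ((v i : ℕ) : ℤ) = ((u i : ℕ) : ℤ) + e i).card ≤
        if e = 0 then 0 else R := by
    intro e he
    rw [PairFieldYang.mem_insert_zero_unitSteps_iff] at he
    rcases he with rfl | rfl | rfl | rfl | rfl
    · rw [if_pos rfl, Nat.le_zero, Finset.card_eq_zero, Finset.filter_eq_empty_iff]
      exact fun u _ h => h ⟨u, fun i => by simp⟩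
    all_goals rw [if_neg (by decide)]
    · exact (Finset.card_le_card (Finset.monotone_filter_right _ fun u _ h =>
        show (u 0 : ℕ) = R - 1 by have := apply_eq_of_not_exists_translate_single h; omega)).trans
        (card_filter_apply_eq_le 0 (R - 1))
    · exact (Finset.card_le_card (Finset.monotone_filter_right _ fun u _ h =>
        apply_eq_zero_of_not_exists_translate_neg_single h)).trans (card_filter_apply_eq_le 0 0)
    · exact (Finset.card_le_card (Finset.monotone_filter_right _ fun u _ h =>
        show (u 1 : ℕ) = R - 1 by have := apply_eq_of_not_exists_translate_single h; omega)).trans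
        (card_filter_apply_eq_le 1 (R - 1))
    · exact (Finset.card_le_card (Finset.monotone_filter_right _ fun u _ h =>
        apply_eq_zero_of_not_exists_translate_neg_single h)).trans (card_filter_apply_eq_le 1 0)
  rw [Finset.card_filter, Finset.sum_product, Finset.sum_comm]
  calc ∑ e ∈ insert (0 : Site 2) unitSteps, ∑ u : Fin 2 → Fin R,
        (if ¬ ∃ v : Fin 2 → Fin R, ∀ i, ((v i : ℕ) : ℤ) = (((u, e).1 i : ℕ) : ℤ) + (u, e).2 i
          then 1 else 0)
      = ∑ e ∈ insert (0 : Site 2) unitSteps, ((Finset.univ : Finset (Fin 2 → Fin R)).filter fun u =>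
          ¬ ∃ v : Fin 2 → Fin R, ∀ i, ((v i : ℕ) : ℤ) = ((u i : ℕ) : ℤ) + e i).card := by
        refine Finset.sum_congr rfl fun e _ => ?_
        rw [Finset.card_filter]
    _ ≤ ∑ e ∈ insert (0 : Site 2) unitSteps, (if e = 0 then 0 else R) := Finset.sum_le_sum hN
    _ = 4 * R := by
        rw [Finset.sum_insert (by decide : (0 : Site 2) ∉ unitSteps), if_pos rfl, zero_add,
          Finset.sum_congr rfl fun e he => if_neg (fun h => absurd he (h ▸ by decide)),
          Finset.sum_const, PairFieldYang.card_unitSteps_eq_four, smul_eq_mul]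

/-- **The boundary part is `O(R)` in norm**: each protruding term is `g_d(e)/√2` times a
difference of two products of two annihilation operators (contractions), and there are at most
`4R` of them: `‖∂_a ψ‖ ≤ 4√2 R ‖ψ‖`. Bratteli–Robinson II §5.2.2 (`‖a(f)‖ ≤ ‖f‖`). [folklore] -/
theorem norm_toLp_blockBoundary_mulVec_le (a : TorusSite 2 L) (R : ℕ)
    (ψ : Fock (Orb (FermionTorus 2 L))) :
    ‖(WithLp.toLp 2 ((∑ p ∈ ((Finset.univ : Finset (Fin 2 → Fin R)) ×ˢ
        insert (0 : Site 2) unitSteps).filter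
          (fun p => ¬ ∃ v : Fin 2 → Fin R, ∀ i, ((v i : ℕ) : ℤ) = ((p.1 i : ℕ) : ℤ) + p.2 i),
        ((dWaveFormFactor p.2 / Real.sqrt 2 : ℝ) : ℂ) •
          (annihilation (orb (FermionTorus.ofTorusSite (a + fun i => ((p.1 i : ℕ) : ZMod L))) 0) *
              annihilation (orb (FermionTorus.ofTorusSite
                ((a + fun i => ((p.1 i : ℕ) : ZMod L)) + Torus.proj L p.2)) 1) -
            annihilation (orb (FermionTorus.ofTorusSite (a + fun i => ((p.1 i : ℕ) : ZMod L))) 1) *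
              annihilation (orb (FermionTorus.ofTorusSite
                ((a + fun i => ((p.1 i : ℕ) : ZMod L)) + Torus.proj L p.2)) 0))) *ᵥ ψ) :
        EuclideanSpace ℂ (Finset (Orb (FermionTorus 2 L))))‖ ≤
      Real.sqrt 2 * (4 * R) *
        ‖(WithLp.toLp 2 ψ : EuclideanSpace ℂ (Finset (Orb (FermionTorus 2 L))))‖ := by
  simp only [Matrix.sum_mulVec, Matrix.smul_mulVec, Matrix.sub_mulVec, ← Matrix.mulVec_mulVec,
    WithLp.toLp_sum, WithLp.toLp_smul, WithLp.toLp_sub]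
  refine (norm_sum_le _ _).trans ?_
  have hterm : ∀ p ∈ ((Finset.univ : Finset (Fin 2 → Fin R)) ×ˢ insert (0 : Site 2) unitSteps).filter
      (fun p => ¬ ∃ v : Fin 2 → Fin R, ∀ i, ((v i : ℕ) : ℤ) = ((p.1 i : ℕ) : ℤ) + p.2 i),
      ‖((dWaveFormFactor p.2 / Real.sqrt 2 : ℝ) : ℂ) •
        ((WithLp.toLp 2 (annihilation (orb (FermionTorus.ofTorusSite
            (a + fun i => ((p.1 i : ℕ) : ZMod L))) 0) *ᵥ
            (annihilation (orb (FermionTorus.ofTorusSite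
              ((a + fun i => ((p.1 i : ℕ) : ZMod L)) + Torus.proj L p.2)) 1) *ᵥ ψ)) :
            EuclideanSpace ℂ (Finset (Orb (FermionTorus 2 L)))) -
          WithLp.toLp 2 (annihilation (orb (FermionTorus.ofTorusSite
            (a + fun i => ((p.1 i : ℕ) : ZMod L))) 1) *ᵥ
            (annihilation (orb (FermionTorus.ofTorusSite
              ((a + fun i => ((p.1 i : ℕ) : ZMod L)) + Torus.proj L p.2)) 0) *ᵥ ψ)))‖ ≤
        Real.sqrt 2 * ‖(WithLp.toLp 2 ψ : EuclideanSpace ℂ (Finset (Orb (FermionTorus 2 L))))‖ := by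
    intro p _
    rw [norm_smul, Complex.norm_real, Real.norm_eq_abs, abs_div, abs_of_pos (Real.sqrt_pos.2 two_pos)]
    have hg : |dWaveFormFactor p.2| / Real.sqrt 2 ≤ 1 / Real.sqrt 2 :=
      div_le_div_of_nonneg_right (by unfold dWaveFormFactor; split_ifs <;> norm_num)
        (Real.sqrt_nonneg _)
    have h2 : ‖(WithLp.toLp 2 (annihilation (orb (FermionTorus.ofTorusSite
            (a + fun i => ((p.1 i : ℕ) : ZMod L))) 0) *ᵥ
            (annihilation (orb (FermionTorus.ofTorusSite
              ((a + fun i => ((p.1 i : ℕ) : ZMod L)) + Torus.proj L p.2)) 1) *ᵥ ψ)) :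
            EuclideanSpace ℂ (Finset (Orb (FermionTorus 2 L)))) -
          WithLp.toLp 2 (annihilation (orb (FermionTorus.ofTorusSite
            (a + fun i => ((p.1 i : ℕ) : ZMod L))) 1) *ᵥ
            (annihilation (orb (FermionTorus.ofTorusSite
              ((a + fun i => ((p.1 i : ℕ) : ZMod L)) + Torus.proj L p.2)) 0) *ᵥ ψ))‖ ≤
        2 * ‖(WithLp.toLp 2 ψ : EuclideanSpace ℂ (Finset (Orb (FermionTorus 2 L))))‖ := by
      refine (norm_sub_le _ _).trans ?_
      rw [two_mul]
      exact add_le_add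
        ((norm_toLp_annihilation_mulVec_le _ _).trans (norm_toLp_annihilation_mulVec_le _ _))
        ((norm_toLp_annihilation_mulVec_le _ _).trans (norm_toLp_annihilation_mulVec_le _ _))
    have hs : 1 / Real.sqrt 2 * 2 = Real.sqrt 2 := by
      rw [one_div_mul_eq_div, Real.div_sqrt]
    calc _ ≤ 1 / Real.sqrt 2 * (2 * ‖(WithLp.toLp 2 ψ : EuclideanSpace ℂ (Finset (Orb (FermionTorus 2 L))))‖) :=
          mul_le_mul hg h2 (norm_nonneg _) (by positivity)
      _ = Real.sqrt 2 * ‖(WithLp.toLp 2 ψ : EuclideanSpace ℂ (Finset (Orb (FermionTorus 2 L))))‖ := by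
          rw [← mul_assoc, hs]
  refine (Finset.sum_le_sum hterm).trans ?_
  rw [Finset.sum_const, nsmul_eq_mul]
  have hc : ((((Finset.univ : Finset (Fin 2 → Fin R)) ×ˢ insert (0 : Site 2) unitSteps).filter
      (fun p => ¬ ∃ v : Fin 2 → Fin R, ∀ i, ((v i : ℕ) : ℤ) = ((p.1 i : ℕ) : ℤ) + p.2 i)).card : ℝ) ≤
      4 * R := by
    exact_mod_cast card_filter_not_exists_translate_le R
  have hn := norm_nonneg (WithLp.toLp 2 ψ : EuclideanSpace ℂ (Finset (Orb (FermionTorus 2 L))))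
  calc _ ≤ (4 * (R : ℝ)) * (Real.sqrt 2 *
        ‖(WithLp.toLp 2 ψ : EuclideanSpace ℂ (Finset (Orb (FermionTorus 2 L))))‖) :=
        mul_le_mul_of_nonneg_right hc (mul_nonneg (Real.sqrt_nonneg 2) hn)
    _ = _ := by ring


/-! ### Registered stub: the split of the block pair operator -/

/-- **Registered stub** (`stub_coarseBlockPairOperatorSplit`, crux stmt-HubbardSuperconductivity-18534):
the split of the block pair operator into the inner `d`-wave kernel part and the boundary part.
Scalapino, Phys. Rep. 250 (1995) 329, §2. [folklore] -/
theorem stub_coarseBlockPairOperatorSplit :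
    ∀ (L : ℕ) [NeZero L] (a : TorusSite 2 L) (R : ℕ),
      (∑ u : Fin 2 → Fin R, localPair dWaveFormFactor L (a + fun i => ((u i : ℕ) : ZMod L))) =
        (∑ u : Fin 2 → Fin R, ∑ v : Fin 2 → Fin R,
          (((∑ e ∈ insert (0 : Site 2) unitSteps,
              if (∀ i, ((v i : ℕ) : ℤ) = ((u i : ℕ) : ℤ) + e i) then dWaveFormFactor e / Real.sqrt 2
              else 0 : ℝ) : ℂ)) •
            (annihilation (orb (FermionTorus.ofTorusSite (a + fun i => ((u i : ℕ) : ZMod L))) 0) *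
                annihilation (orb (FermionTorus.ofTorusSite (a + fun i => ((v i : ℕ) : ZMod L))) 1) -
              annihilation (orb (FermionTorus.ofTorusSite (a + fun i => ((u i : ℕ) : ZMod L))) 1) *
                annihilation (orb (FermionTorus.ofTorusSite (a + fun i => ((v i : ℕ) : ZMod L))) 0))) +
        ∑ p ∈ ((Finset.univ : Finset (Fin 2 → Fin R)) ×ˢ insert (0 : Site 2) unitSteps).filter
            (fun p => ¬ ∃ v : Fin 2 → Fin R, ∀ i, ((v i : ℕ) : ℤ) = ((p.1 i : ℕ) : ℤ) + p.2 i),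
          ((dWaveFormFactor p.2 / Real.sqrt 2 : ℝ) : ℂ) •
            (annihilation (orb (FermionTorus.ofTorusSite (a + fun i => ((p.1 i : ℕ) : ZMod L))) 0) *
                annihilation (orb (FermionTorus.ofTorusSite
                  ((a + fun i => ((p.1 i : ℕ) : ZMod L)) + Torus.proj L p.2)) 1) -
              annihilation (orb (FermionTorus.ofTorusSite (a + fun i => ((p.1 i : ℕ) : ZMod L))) 1) *
                annihilation (orb (FermionTorus.ofTorusSite
                  ((a + fun i => ((p.1 i : ℕ) : ZMod L)) + Torus.proj L p.2)) 0)) :=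
  fun _ _ a R => blockPairOperator_split_raw a R

end Torus

end Summit.HubbardSuperconductivity.HubbardSuperconductivity.Theorems.CoarseTightness

end
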